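import Summits.CriticalPhenomena.SAWScalingLimit.Theorems.SAWRenewalTightnessAnnularMassDecayLastRenewalReduction

/-!
# Line `last-renewal-delocalization` for the crux `SAWRenewalTightness.AnnularMassDecay` (stmt-CriticalPhenomena-4729)

Crux-strategist skeleton (wall-breaker seat `planner-cstrat-stmt-CriticalPhenomena-4729-p1-0`, 2026-08-17), reshaped and
THINNED by the lead `prover-line-stmt-CriticalPhenomena-4729-c3-0` (cycle 1, 2026-08-17) after four of its six stubs LANDED:

* S1 `stub_lastRenewalDecoupling` — p141438 `Theorems/SAWRenewalTightnessAnnularMassDecayLastRenewalDecoupling.lean`;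
* S2a `stub_straddleBlocks` — p145503 `…StraddleBlocks.lean`; S2b `stub_bridgeCodeCount` — p146866 `…BridgeCodeCount.lean`;
  S2c `stub_kraftOfCount` — p148970 `…KraftOfCount.lean`; assembled as `lr_lastRenewalStraddle` (S2) and composed with S1 into
  the REDUCTION `lr_annularMassDecay_of_open_stubs : S3 → S4 → AnnularMassDecay` in
  `Theorems/SAWRenewalTightnessAnnularMassDecayLastRenewalReduction.lean` (imported here);
* vocabulary in `Theorems/SAWRenewalTightnessAnnularMassDecayLastRenewalDefs.lean` (p140001, p140336).

What remains are the two OPEN stubs below (`sorry` lives only in them): S3 `stub_transversalDelocalization` (REPAIRED by the lead: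
the strategist's form with arbitrary windows `t < ℓ` is false for irrational directions through height windows thinner than the
lattice — see `Lines/last-renewal-delocalization.md` §Reshape — the registered form asks `t + ρ ≤ ℓ`) and S4
`stub_irreduciblePrefixOneArm` (HARDEST; even its `θ₂ = 0` bounded-aspect content is of the strength of finiteness of a restricted
critical two-point function on `ℤ²`).  `AnnularMassDecay_of` is now one line: the landed reduction applied to the two stubs.

The lever, the cut, the bookkeeping identity and the glue are documented in the module docstring of the Reduction file and on the
line card.

## Disproof used (`Cruxes/AnnularMassDecay/Disproof.lean`, cycles 1–2; landed `Negative/{LoadBearing,Structure,HalfPlaneDivergence,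
AvoidInner}`): `false_without_startOutside` (half-plane property, used in S1), `false_without_innerRadiusOne` (`1 ≤ r` in S4 and
`lr_final_bound`), `false_without_endInside` + `annularMassDecay_false_without_avoidInner` (both clauses kept in `pfxMass`),
`annularMassDecay_iff_posR` (consistent), §D numerics (consistent with `θ₂ ≈ 0.47`, `a ≈ 1`), §H (no radial kernel).  No `-- Targets`
section exists for this line (Disproof.lean at its cycle-2 state); cheapest falsifiers for S3/S4 are on the line card.
-/

noncomputable section

namespace Summit.CriticalPhenomena.SAWScalingLimit.Cruxes.AnnularMassDecay.LastRenewalDelocalization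

open scoped BigOperators Classical ComplexConjugate
open Literature.Probability.LatticeModels Literature.Probability.RandomPlanarGeometry
open Summit.CriticalPhenomena.SAWScalingLimit.Theses.SAWRenewalTightness (AnnularMassDecay)
open Summit.CriticalPhenomena.SAWScalingLimit.Theorems.AnnularMassDecay.Negative
  (annMass annularMassDecay_iff criticalFugacity_pos)
open Summit.CriticalPhenomena.SAWScalingLimit.Theorems.AnnularMassDecay.LastRenewal

/-! ## The two open stub STATEMENTS as named `Prop`s -/

/-- S3 statement (REPAIRED) — TRANSVERSAL DELOCALISATION of the last renewal point below a level, relative form, for height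
windows `[t, ℓ)` at least as thick as the ball radius (`t + ρ ≤ ℓ`): the cut points in a ball of radius `ρ` at heights in
`[t, ℓ)` (`1 ≤ ρ ≤ t`) carry at most `C₁ (ρ/t)^a` of the total straddling weight of the cut points at heights in `[t, ℓ)`. -/
def TransversalDelocalization : Prop :=
  ∃ a C₁ : ℝ, 0 < a ∧ 0 < C₁ ∧ ∀ (e : ℂ), ‖e‖ = 1 → ∀ (u : Site 2) (c : ℂ) (ρ t ℓ : ℝ),
    1 ≤ ρ → ρ ≤ t → t + ρ ≤ ℓ → ∀ (S : Finset (Site 2)) (N N' : ℕ), ∃ N'' N''' : ℕ,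
      ∑ x ∈ S.filter (fun x => dist (Site.toComplex (u + x)) c < ρ ∧ t ≤ ht e u (u + x) ∧ ht e u (u + x) < ℓ),
          brMass e u x N * irrTail e (ℓ - ht e u (u + x)) N'
        ≤ C₁ * (ρ / t) ^ a *
          ∑ x ∈ ((box 2 N'').filter (fun x => t ≤ ht e u (u + x))).filter (fun x => ht e u (u + x) < ℓ),
            brMass e u x N'' * irrTail e (ℓ - ht e u (u + x)) N'''

/-- S4 statement — IRREDUCIBLE-PREFIX ONE-ARM: the last-excursion mass from `v = u + x` is at most
`C₂ · p̄(ℓ - h(v)) · (r/|v - z|)^{θ₂}` (one `N'` serving all `x`, for each `N`). -/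
def IrreduciblePrefixOneArm : Prop :=
  ∃ θ₂ C₂ : ℝ, 0 < θ₂ ∧ 0 < C₂ ∧ ∀ (z : ℂ) (r R : ℝ), 1 ≤ r → r < R → ∀ (u : Site 2),
    R ≤ dist (Site.toComplex u) z → ∀ N : ℕ, ∃ N' : ℕ, ∀ x : Site 2,
      pfxMass z r R u x N ≤ C₂ * irrTail (frameDir z u) (botLevel z r u - ht (frameDir z u) u (u + x)) N' *
        (r / dist (Site.toComplex (u + x)) z) ^ θ₂

/-! ## The registered stubs (`sorry` lives only in these two theorems) -/

/-- **S3 · `stub_transversalDelocalization`** (REPAIRED) — TRANSVERSAL DELOCALISATION OF THE LAST RENEWAL POINT (OPEN, XL).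
There are `a > 0`, `C₁` such that for every unit `e`, start `u`, ball centre `c`, radii/levels `1 ≤ ρ ≤ t`, `t + ρ ≤ ℓ`, finite
`S`, `N, N'` there are `N'', N'''` with
`Σ_{x ∈ S : |u+x-c| < ρ, t ≤ h(u+x) < ℓ} b_N p̄_{N'}(ℓ - h) ≤ C₁ (ρ/t)^a · Σ_{x ∈ box N'' : t ≤ h(u+x) < ℓ} b_{N''} p̄_{N'''}(ℓ - h)`.
Meaning (Kesten measure `P_K^{u,e}`, i.i.d. irreducible pieces; `b(u → v)·p̄(ℓ - h(v)) = P_K(V = v)` for `V :=` the last renewal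
point strictly below level `ℓ`): `P_K(V ∈ B(c, ρ), h(V) ≥ t) ≤ C₁ (ρ/t)^a · P_K(h(V) ≥ t)` whenever the height window
`[t, ℓ)` is at least `ρ` thick — conditioned on being high, the last renewal point below a level is transversally spread over its
height scale.  RELATIVE statement: it neither requires nor gives any decay of bridge masses `u_L`.
WHY THE REPAIR (`t + ρ ≤ ℓ` instead of `t < ℓ`; lead c3): for an IRRATIONAL direction `e` heights are injective on `ℤ²`, so for a
lattice point `x₀` near the axis `u + ℝe` at height `t := h(x₀) ≫ 1` one can choose `ℓ - t` smaller than the height gap to every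
other lattice point within transversal distance `K t`; then (`S = {x₀}`, `c = u + x₀`, `ρ = 1`) both sides see the single cut point
`x₀` up to the exponentially small mass of `e`-bridges of height `< t + 1` and width `> K t` (strip walks, `μ_strip(t) < μ`), the
ratio tends to `1`, and `1 ≤ C₁ t^{-a}` fails for large `t` — the old form was false for every irrational `e`, though only through
windows thinner than one lattice spacing, which the composition never used (it needs the window `[ℓ - ρ₀, ℓ)`, `ρ = ρ₀`).
Why plausibly true (thick windows): `V` is the position of Kesten's bridge at a renewal at height `∈ [t, ℓ)`; its abscissa is the
sum of the transversal displacements of the `≍ t^{3/4}` pieces below, spread over width `≍ t`; the continuum shadow is DGKLP's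
conjecture `Z_{strip_y}(0, x + iy) ∼ ρ(x/y) y^{-2b}`, `ρ ∝ [cosh(πx/2)]^{-5/4}` BOUNDED (arXiv:1008.4321 (1.1), §3.2), giving
`a = 1`; any `a > 0` suffices.  Partial mechanism (axis/diagonal `e`): reflecting the FUTURE of a bridge at a renewal point across
`{v + ℝe}` is a weight- and span-preserving involution, so given the multiset of pieces the abscissa is a Rademacher sum
`Σ ε_i |D_i|`; Kolmogorov–Rogozin bounds its concentration by `C ρ / √(Σ_i min(|D_i|, ρ)²)`; what remains is a SPREAD statement
(enough pieces with `|D_i| ≳ ρ` below height `t`, except on a set of relative weight `(ρ/t)^a`).  Why it might fail: atoms of the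
transversal law of relative size `≫ (ρ/t)^a` in a thick window — for axis directions excluded by the Rademacher structure whenever
many pieces move sideways; a failure would contradict DGKLP §3.2.  Cheapest falsifier: PERM/transfer-matrix on `x_c`-bridges of
span `k ≤ 64` (`e = e₂`, then `e = (1,2)/√5`): the largest fraction of span-`k` bridge mass ending in a transversal window of
width `2ρ`, against `(ρ/k)^a`.  [DGKLP2011 = arXiv:1008.4321 §2, (1.1), §3.2; Kesten1963SAW; MadrasSlade1993 §4.2;
arXiv:1205.0401 §2.3] -/
theorem stub_transversalDelocalization :
    ∃ a C₁ : ℝ, 0 < a ∧ 0 < C₁ ∧ ∀ (e : ℂ), ‖e‖ = 1 → ∀ (u : Site 2) (c : ℂ) (ρ t ℓ : ℝ),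
      1 ≤ ρ → ρ ≤ t → t + ρ ≤ ℓ → ∀ (S : Finset (Site 2)) (N N' : ℕ), ∃ N'' N''' : ℕ,
        ∑ x ∈ S.filter (fun x => dist (Site.toComplex (u + x)) c < ρ ∧ t ≤ ht e u (u + x) ∧ ht e u (u + x) < ℓ),
            brMass e u x N * irrTail e (ℓ - ht e u (u + x)) N'
          ≤ C₁ * (ρ / t) ^ a *
            ∑ x ∈ ((box 2 N'').filter (fun x => t ≤ ht e u (u + x))).filter (fun x => ht e u (u + x) < ℓ),
              brMass e u x N'' * irrTail e (ℓ - ht e u (u + x)) N''' := by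
  sorry

/-- **S4 · `stub_irreduciblePrefixOneArm`** — ONE-ARM FOR A SINGLE IRREDUCIBLE EXCURSION (OPEN, size XL, HARDEST).
There are `θ₂ > 0`, `C₂` such that in the crux geometry, for every `N` there is `N'` with, for every offset `x` (`v := u + x`):
`N°_N(v) ≤ C₂ · p̄_{N'}(ℓ - h(v)) · (r / |v - z|)^{θ₂}`.
Meaning: a walk from a renewal point `v` that reaches the disc level `ℓ` WITHOUT renewing below `ℓ` is (up to its last renewal,
which is at height `≥ ℓ`, or entirely if it has none) a prefix of ONE irreducible piece of span `≥ ℓ - h(v)` (cost `p̄(ℓ - h(v))`,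
the exact factor the identity S2 consumes), and it must find a disc of radius `r` at distance `|v - z| ≥ r + (ℓ - h(v))` (cost
`(r/|v - z|)^{θ₂}`: aiming).  Un-weighting (mass of prefixes vs. mass of completed pieces) is demanded only up to a power of
`|v - z|/r`.  Uniformity in the REAL direction `e = frameDir z u` is part of the claim (near-axis irrational `e` have more renewals
per unit height and thinner irreducible pieces; both sides move together, no anomaly found by the lead's degenerate-regime audit:
thin bands `ℓ - h(v) ≪ 1`, `v` outside the outer circle, `v` adjacent to the disc).
Why plausibly true: box-counting — a curve of dimension `4/3` passing within `O(d)` of `z` meets a given `r`-disc with probability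
`≍ (r/d)^{2/3}`; the mass/probability discrepancy of disc-entry families grows only like `(d/r)^{0.16–0.19}` (measured,
`B-C-untrapping-esc-scan.md`), leaving `θ₂ ≈ 0.47`; Coulomb-gas bookkeeping at `v = u`: `N° ≍ R^{-35/48} · p̄(R)` against
`p̄(R) R^{-θ₂}`.  At `v` adjacent to the disc (`p̄ ≈ 1`) the claim is the bounded-aspect `θ = 0` content (`K₀ ≈ 1.1–1.2` in every
scan); at `v = u` it is the renewal-free SUB-family of the crux with the EXTRA factor `p̄(|u - z| - 2r) ≤ 1`.
Why open: a uniform one-arm bound for a critical `x_c`-mass on `ℤ²` in curved geometry — no technique in print (KP23 p.2;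
Madras–Slade p.77).  Keeps the endpoint and inner-avoidance clauses (else false by `annularMassDecay_false_without_avoidInner`) and
`1 ≤ r`.  Cheapest falsifier: PERM on the `pfxMass` family at `v = u` on-axis, `r = 2`, `R = 8 … 128`: `N°(u)/p̄(R - 2)` against
`(2/R)^{θ₂}`; and the bounded-aspect ratio `N°(v)/p̄` for `v` one–three levels below the disc.
[arXiv:1008.4321 §2.2; arXiv:1205.0401; MadrasSlade1993 §4.2; LawlerSchrammWerner2004SAW (exponents)] -/
theorem stub_irreduciblePrefixOneArm :
    ∃ θ₂ C₂ : ℝ, 0 < θ₂ ∧ 0 < C₂ ∧ ∀ (z : ℂ) (r R : ℝ), 1 ≤ r → r < R → ∀ (u : Site 2),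
      R ≤ dist (Site.toComplex u) z → ∀ N : ℕ, ∃ N' : ℕ, ∀ x : Site 2,
        pfxMass z r R u x N ≤ C₂ * irrTail (frameDir z u) (botLevel z r u - ht (frameDir z u) u (u + x)) N' *
          (r / dist (Site.toComplex (u + x)) z) ^ θ₂ := by
  sorry

/-! ### Consistency: each named statement IS its registered stub (definitionally) -/

theorem transversalDelocalization_holds : TransversalDelocalization := stub_transversalDelocalization
theorem irreduciblePrefixOneArm_holds : IrreduciblePrefixOneArm := stub_irreduciblePrefixOneArm

/-! ### Name-keyed aliases (the hypotheses of the composition) -/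
namespace Registered

/-- Alias of `TransversalDelocalization` keyed by the registered stub name. -/
abbrev stub_transversalDelocalization : Prop := TransversalDelocalization
/-- Alias of `IrreduciblePrefixOneArm` keyed by the registered stub name. -/
abbrev stub_irreduciblePrefixOneArm : Prop := IrreduciblePrefixOneArm

end Registered

/-! ## The composition: the two open stubs imply the crux, BY NAME, through the landed reduction -/

/-- **`AnnularMassDecay_of`** — the landed reduction `lr_annularMassDecay_of_open_stubs` (S1, S2 discharged inside it) applied to
S3 and S4 concludes `Summit.CriticalPhenomena.SAWScalingLimit.Theses.SAWRenewalTightness.AnnularMassDecay`. -/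
theorem AnnularMassDecay_of (h₃ : Registered.stub_transversalDelocalization)
    (h₄ : Registered.stub_irreduciblePrefixOneArm) : AnnularMassDecay :=
  lr_annularMassDecay_of_open_stubs h₃ h₄

/-- Wiring check: the registered stubs feed `AnnularMassDecay_of` as stated. -/
example : AnnularMassDecay := AnnularMassDecay_of stub_transversalDelocalization stub_irreduciblePrefixOneArm

end Summit.CriticalPhenomena.SAWScalingLimit.Cruxes.AnnularMassDecay.LastRenewalDelocalization

end
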